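import Literature.NumberTheory.DiophantineApproximation.DilogLandenLinearIndependenceProofs
import Literature.Analysis.Asymptotics.LaplaceSupNormLimit
import Literature.NumberTheory.Transcendental.ZetaLinearFormsCriterion
import HarnessLib

/-!
# Viola–Zudilin 2018 — proofs, part I bis: the fact from the rates `c₃ < c₀ < c₁` (Prop. 6.1 skeleton)

Topic `Literature/NumberTheory/DiophantineApproximation`; pure-proof companion of
`DilogLandenLinearIndependence.lean` / `DilogLandenLinearIndependenceProofs.lean` (no definitions, no
named facts). Source: C. Viola, W. Zudilin, *Linear independence of dilogarithmic values*, J. reine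
angew. Math. 736 (2018), §6.1, Proposition 6.1: "if `c₃ < c₀ < c₁`, the numbers
`1, Li₁(1/z), Li₂(1/z), Li₂(1/(1−z))` are linearly independent over `ℚ`", where (Props. 3.1, 4.1) the
linear forms are `r_n^{(1)} = A_n J_z^{(1)} ∈ ℤLi₁(1/z) + ℤ`, `r_n^{(2)} = A_n K_z ∈ ℤ·½Li₁(1/z)² + ℤ`,
`r_n^{(3)} = A_n J_z ∈ ℤLi₂(1/z) + ℤ`, with the arithmetic normaliser
`A_n = Δ_n^{-1} d_{Hn} d_{H'n} z^{αn}(1−z)^{βn}` of rate `lim (1/n) log A_n = c₃`, and the analytic rates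
`lim (1/n) log |J_z| = −c₀`, `limsup (1/n) log |J_z^{(1)}| ≤ −c₁`, `lim (1/n) log |K_z| ≤ −c₁`.

THIS FILE proves that skeleton abstractly (`exists_forms_of_rates`: the `ρ₁ < ρ₂` data of
`ViolaZudilin2018_dilogLandenLinearIndependent_of_forms` from ANY normaliser/remainder sequences with such
rates and the three integer identities) and assembles
`ViolaZudilin2018_dilogLandenLinearIndependent_of_rates`: **the named fact follows from, for every
integer `q ≥ 9`, real sequences `A_n > 0`, `R_n^{(1)}, R_n^{(2)}, R_n^{(3)}` and integers `Q_n, P_n^{(μ)}` with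
`Q_n Li₁(1/q) − P_n^{(1)} = A_n R_n^{(1)}`, `Q_n ½Li₁(1/q)² − P_n^{(2)} = A_n R_n^{(2)}`,
`Q_n Li₂(1/q) − P_n^{(3)} = A_n R_n^{(3)}`, `(1/n) log A_n → c₃`, `(1/n) log |R_n^{(3)}| → −c₀`,
`|R_n^{(1)}|, |R_n^{(2)}| ≤ e^{(−c₁+ε)n}` eventually for every `ε > 0`, and `c₃ < c₀ < c₁`** — exactly the
deliverables of Propositions 3.1 (identities, `A_n`) and 4.1 (rates) of the paper, which remain to be
formalized (see `ViolaZudilinIntegrals.lean` for `J_z^{(0)}` and the existence of its rate). The last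
section gives the rate `c₃ = H + H'` of the plain normaliser `d_{Hn} d_{H'n}` (prime number theorem), the
case `α = β = 0`, `r = 1`, `Ω = ∅` of the paper's `c₃` (§6.1; e.g. `c₃ = 23` for `z ≥ 24`, §6.2).

## References

* C. Viola, W. Zudilin, J. reine angew. Math. 736 (2018) 193–223, §6.1, Proposition 6.1.
  [ViolaZudilin2018]
-/

noncomputable section

namespace Literature.NumberTheory.DiophantineApproximation

namespace ViolaZudilin

open _root_.Filter _root_.Topology
open DilogPade (polylogSeries)

/-- **From the rates `c₃ < c₀ < c₁` to the `ρ₁ < ρ₂` data of Lemma 5.1** (the bookkeeping in the proof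
of Viola–Zudilin's Proposition 6.1): let `r_n^{(μ)} = Q_n γ_μ − P_n^{(μ)} = A_n R_n^{(μ)}` (`μ = 1, 2, 3`) with
`A_n > 0`, `(1/n) log A_n → c₃`, `R_n^{(3)} ≠ 0`, `(1/n) log |R_n^{(3)}| → −c₀`, and
`|R_n^{(1)}|, |R_n^{(2)}| ≤ e^{(−c₁+ε)n}` eventually, for every `ε > 0`. If `c₃ < c₀ < c₁` then, with
`ε = min((c₁−c₀)/8, (c₀−c₃)/4)`, `ρ₂ = c₁ − c₃ − 2ε > ρ₁ = c₀ − c₃ + 2ε` (and `ρ₂ > 0`):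
`|r_n^{(1)}|, |r_n^{(2)}| ≤ e^{−ρ₂n}` and `e^{−ρ₁n} ≤ |r_n^{(3)}| ≤ e^{−((c₀−c₃)−2ε)n}` for all large `n`;
in particular `r_n^{(3)} → 0`. [cite: ViolaZudilin2018, Prop. 6.1 (proof, §6.1)] -/
theorem exists_forms_of_rates (γ₁ γ₂ γ₃ : ℝ) (Q P₁ P₂ P₃ : ℕ → ℤ) (A R₁ R₂ R₃ : ℕ → ℝ)
    {c₀ c₁ c₃ : ℝ} (hc₃₀ : c₃ < c₀) (hc₀₁ : c₀ < c₁) (hA : ∀ n, 0 < A n)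
    (hArate : Tendsto (fun n : ℕ => Real.log (A n) / n) atTop (𝓝 c₃))
    (h₁ : ∀ n, (Q n : ℝ) * γ₁ - P₁ n = A n * R₁ n) (h₂ : ∀ n, (Q n : ℝ) * γ₂ - P₂ n = A n * R₂ n)
    (h₃ : ∀ n, (Q n : ℝ) * γ₃ - P₃ n = A n * R₃ n) (hR₃ne : ∀ n, R₃ n ≠ 0)
    (hR₃rate : Tendsto (fun n : ℕ => Real.log |R₃ n| / n) atTop (𝓝 (-c₀)))
    (hR₁ : ∀ ε : ℝ, 0 < ε → ∀ᶠ n : ℕ in atTop, |R₁ n| ≤ Real.exp ((-c₁ + ε) * n))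
    (hR₂ : ∀ ε : ℝ, 0 < ε → ∀ᶠ n : ℕ in atTop, |R₂ n| ≤ Real.exp ((-c₁ + ε) * n)) :
    ∃ ρ₁ ρ₂ : ℝ, ρ₁ < ρ₂ ∧ 0 < ρ₂ ∧
      (∀ᶠ n : ℕ in atTop, |Q n * γ₁ - P₁ n| ≤ Real.exp (-(ρ₂ * n))) ∧
      (∀ᶠ n : ℕ in atTop, |Q n * γ₂ - P₂ n| ≤ Real.exp (-(ρ₂ * n))) ∧
      Tendsto (fun n : ℕ => Q n * γ₃ - P₃ n) atTop (𝓝 0) ∧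
      (∃ᶠ n : ℕ in atTop, Real.exp (-(ρ₁ * n)) ≤ |Q n * γ₃ - P₃ n|) := by
  set ε : ℝ := min ((c₁ - c₀) / 8) ((c₀ - c₃) / 4) with hε
  have hε0 : 0 < ε := lt_min (by linarith) (by linarith)
  have hε₁ : ε ≤ (c₁ - c₀) / 8 := min_le_left _ _
  have hε₂ : ε ≤ (c₀ - c₃) / 4 := min_le_right _ _
  set ρ₁ : ℝ := c₀ - c₃ + 2 * ε with hρ₁
  set ρ₂ : ℝ := c₁ - c₃ - 2 * ε with hρ₂
  -- two-sided exponential bounds for `A_n` and `|R₃ n|`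
  have hAb := Literature.Analysis.Asymptotics.eventually_exp_mul_le_and_le_exp_mul hA hArate hε0
  have hR₃b := Literature.Analysis.Asymptotics.eventually_exp_mul_le_and_le_exp_mul
    (fun n => abs_pos.2 (hR₃ne n)) hR₃rate hε0
  -- the small forms
  have hsmall : ∀ (R : ℕ → ℝ) (P : ℕ → ℤ) (γ : ℝ), (∀ n, (Q n : ℝ) * γ - P n = A n * R n) →
      (∀ᶠ n : ℕ in atTop, |R n| ≤ Real.exp ((-c₁ + ε) * n)) →
      ∀ᶠ n : ℕ in atTop, |Q n * γ - P n| ≤ Real.exp (-(ρ₂ * n)) := by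
    intro R P γ hRP hRb
    filter_upwards [hAb, hRb] with n hAn hRn
    rw [hRP n, abs_mul, abs_of_pos (hA n)]
    calc A n * |R n| ≤ Real.exp ((c₃ + ε) * n) * Real.exp ((-c₁ + ε) * n) :=
          mul_le_mul hAn.2 hRn (abs_nonneg _) (Real.exp_pos _).le
      _ = Real.exp (-(ρ₂ * n)) := by rw [← Real.exp_add, hρ₂]; ring_nf
  -- the big form: `e^{-ρ₁ n} ≤ |r₃ n| ≤ e^{-((c₀ - c₃) - 2ε) n}`
  have hbig : ∀ᶠ n : ℕ in atTop, Real.exp (-(ρ₁ * n)) ≤ |Q n * γ₃ - P₃ n| ∧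
      |Q n * γ₃ - P₃ n| ≤ Real.exp (-((c₀ - c₃ - 2 * ε) * n)) := by
    filter_upwards [hAb, hR₃b] with n hAn hRn
    rw [h₃ n, abs_mul, abs_of_pos (hA n)]
    constructor
    · calc Real.exp (-(ρ₁ * n)) = Real.exp ((c₃ - ε) * n) * Real.exp ((-c₀ - ε) * n) := by
            rw [← Real.exp_add, hρ₁]; ring_nf
        _ ≤ A n * |R₃ n| := mul_le_mul hAn.1 hRn.1 (Real.exp_pos _).le (hA n).le
    · calc A n * |R₃ n| ≤ Real.exp ((c₃ + ε) * n) * Real.exp ((-c₀ + ε) * n) :=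
            mul_le_mul hAn.2 hRn.2 (abs_nonneg _) (Real.exp_pos _).le
        _ = Real.exp (-((c₀ - c₃ - 2 * ε) * n)) := by rw [← Real.exp_add]; ring_nf
  refine ⟨ρ₁, ρ₂, by linarith, by linarith, hsmall R₁ P₁ γ₁ h₁ (hR₁ ε hε0),
    hsmall R₂ P₂ γ₂ h₂ (hR₂ ε hε0), ?_, hbig.frequently.mono fun n hn => hn.1⟩
  -- `r₃ → 0` from the upper bound with positive rate
  have hrate : 0 < c₀ - c₃ - 2 * ε := by linarith
  refine squeeze_zero_norm' (hbig.mono fun n hn => ?_) (tendsto_exp_neg_mul hrate)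
  rw [Real.norm_eq_abs]
  exact hn.2

/-- **Viola–Zudilin 2018, Main theorem, from the rates `c₃ < c₀ < c₁`** (the skeleton of Proposition 6.1
over `ViolaZudilin2018_dilogLandenLinearIndependent_of_forms`): IF for every integer `q ≥ 9` there are
reals `c₃ < c₀ < c₁`, a normaliser `A_n > 0` with `(1/n) log A_n → c₃` (the paper's
`Δ_n^{-1} d_{Hn} d_{H'n}`: Prop. 3.1 and the prime number theorem), remainders `R_n^{(3)} ≠ 0` with
`(1/n) log |R_n^{(3)}| → −c₀` (`J_q`) and `R_n^{(1)}, R_n^{(2)}` with `|R_n^{(μ)}| ≤ e^{(−c₁+ε)n}` eventually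
for every `ε > 0` (`J_q^{(1)}, K_q`: Prop. 4.1), and integers `Q_n, P_n^{(1)}, P_n^{(2)}, P_n^{(3)}` with
`Q_n Li₁(1/q) − P_n^{(1)} = A_n R_n^{(1)}`, `Q_n ½Li₁(1/q)² − P_n^{(2)} = A_n R_n^{(2)}`,
`Q_n Li₂(1/q) − P_n^{(3)} = A_n R_n^{(3)}` (Prop. 3.1), THEN the named fact holds.
[cite: ViolaZudilin2018, Prop. 6.1 and Main theorem] -/
theorem
    _root_.Literature.NumberTheory.DiophantineApproximation.ViolaZudilin2018_dilogLandenLinearIndependent_of_rates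
    (H : ∀ q : ℕ, 9 ≤ q → ∃ (c₀ c₁ c₃ : ℝ) (A R₁ R₂ R₃ : ℕ → ℝ) (Q P₁ P₂ P₃ : ℕ → ℤ),
      c₃ < c₀ ∧ c₀ < c₁ ∧ (∀ n, 0 < A n) ∧
      Tendsto (fun n : ℕ => Real.log (A n) / n) atTop (𝓝 c₃) ∧
      (∀ n, (Q n : ℝ) * polylogSeries 1 (1 / (q : ℝ)) - P₁ n = A n * R₁ n) ∧
      (∀ n, (Q n : ℝ) * (polylogSeries 1 (1 / (q : ℝ)) ^ 2 / 2) - P₂ n = A n * R₂ n) ∧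
      (∀ n, (Q n : ℝ) * polylogSeries 2 (1 / (q : ℝ)) - P₃ n = A n * R₃ n) ∧
      (∀ n, R₃ n ≠ 0) ∧ Tendsto (fun n : ℕ => Real.log |R₃ n| / n) atTop (𝓝 (-c₀)) ∧
      (∀ ε : ℝ, 0 < ε → ∀ᶠ n : ℕ in atTop, |R₁ n| ≤ Real.exp ((-c₁ + ε) * n)) ∧
      (∀ ε : ℝ, 0 < ε → ∀ᶠ n : ℕ in atTop, |R₂ n| ≤ Real.exp ((-c₁ + ε) * n))) :
    ViolaZudilin2018_dilogLandenLinearIndependent := by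
  refine ViolaZudilin2018_dilogLandenLinearIndependent_of_forms fun q hq => ?_
  obtain ⟨c₀, c₁, c₃, A, R₁, R₂, R₃, Q, P₁, P₂, P₃, hc₃₀, hc₀₁, hA, hArate, h₁, h₂, h₃, hR₃ne,
    hR₃rate, hR₁, hR₂⟩ := H q hq
  obtain ⟨ρ₁, ρ₂, hρ, hρ₂, hs₁, hs₂, ht₃, hb₃⟩ := exists_forms_of_rates _ _ _ Q P₁ P₂ P₃ A R₁ R₂ R₃
    hc₃₀ hc₀₁ hA hArate h₁ h₂ h₃ hR₃ne hR₃rate hR₁ hR₂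
  exact ⟨Q, P₁, P₂, P₃, ρ₁, ρ₂, hρ, hρ₂, hs₁, hs₂, ht₃, hb₃⟩

/-! ### The plain normaliser `d_{Hn} d_{H'n}` (no permutation group): `c₃ = H + H'` -/

/-- `(1/n) log D_{cn} → c` for a positive integer `c`, `D_N = lcm(1,…,N)` (prime number theorem,
`Literature.NumberTheory.Transcendental.tendsto_log_lcmUpto_div`). [folklore] -/
theorem tendsto_log_lcmUpto_mul_div {c : ℕ} (hc : 0 < c) :
    Tendsto (fun n : ℕ => Real.log (Nat.lcmUpto (c * n)) / n) atTop (𝓝 (c : ℝ)) := by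
  have h := (Literature.NumberTheory.Transcendental.tendsto_log_lcmUpto_div.comp
    (tendsto_id.const_mul_atTop' hc)).const_mul (c : ℝ)
  rw [mul_one] at h
  refine h.congr' ?_
  filter_upwards [eventually_ge_atTop 1] with n hn
  simp only [Function.comp_apply, id]
  have hn0 : (n : ℝ) ≠ 0 := by exact_mod_cast (show n ≠ 0 by omega)
  have hc0 : (c : ℝ) ≠ 0 := by exact_mod_cast hc.ne'
  push_cast
  field_simp

/-- **The rate of the plain normaliser `d_{Hn} d_{H'n}`**: `(1/n) log (D_{Hn} D_{H'n}) → H + H'` for positive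
integers `H, H'` — the constant `c₃ = H + H'` of Viola–Zudilin's Proposition 6.1 in the case `α = β = 0`,
`r = 1`, `Ω = ∅` (no permutation-group saving; e.g. `c₃ = 23` for `(h,…,q) = (9,9,5,4,5,1)`, `z ≥ 24`).
[cite: ViolaZudilin2018, §6.1 (c₃) and §6.2 (z ≥ 24)] -/
theorem tendsto_log_lcmUpto_mul_lcmUpto_div {a b : ℕ} (ha : 0 < a) (hb : 0 < b) :
    Tendsto (fun n : ℕ => Real.log ((Nat.lcmUpto (a * n) : ℝ) * Nat.lcmUpto (b * n)) / n) atTop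
      (𝓝 ((a : ℝ) + b)) := by
  refine ((tendsto_log_lcmUpto_mul_div ha).add (tendsto_log_lcmUpto_mul_div hb)).congr fun n => ?_
  have h1 : (Nat.lcmUpto (a * n) : ℝ) ≠ 0 := by exact_mod_cast (Nat.lcmUpto_pos _).ne'
  have h2 : (Nat.lcmUpto (b * n) : ℝ) ≠ 0 := by exact_mod_cast (Nat.lcmUpto_pos _).ne'
  rw [Real.log_mul h1 h2, add_div]

end ViolaZudilin

end Literature.NumberTheory.DiophantineApproximation

end
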